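import Summits.ABC.IUTFork.Cor312GenuineKDeepDatumLam
import Summits.ABC.IUTFork.Repair.CandInternal2RealStrata
import HarnessLib

/-!
# IUT REPAIR BRANCH (rung LADDER-ABC:A2.RP → A2.RESCUE-H), class (i) INTERNAL, sub-cell B0, seat rp-d2 — `CandInternal2RealHex`: the
# «HEX-I06STAR-NEG FAMILY THEOREM» — at the genuine place `x₀ | 7` of the `λ_k = 1/2 + 2/7^k` K-line the TOP-LABEL cell of RP-I06⋆ FAILS

PROOF-ONLY file (D-0012; 0 definitions, 0 `Prop` facts) of the abc-iut cell, IUT REPAIR branch; seat abc-iut-rp-d2 gen 3 (D-0079 R-H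
numerics/kernel-eval hand; abc-iut-rh-lead 15:23:52Z NEXT TASK «HEX-I06STAR-NEG FAMILY THEOREM»: one theorem turning the 246 NEG routing signals
of `plan/rescue/R-H/I06STAR-COLUMNS.tsv` v1 on R-W's HEX rows into DECIDED cells). TAKES NO SIDE on [IUTchIII] Cor. 3.12 or on any author; a
statement about OUR typed objects — abc-iut-c312-7's genuine place `Conditional.GenuineK.exists_place_lamSeven` (p447xxx lineage: `x₀ | 7` of
`K = T.K` in the bad set, tame over `ℚ_7`, `e(K_{x₀}/ℚ_7) ≤ 46080·l(l−1)²(l+1)`, `‖t_q(x₀)‖ = 7^{−k/l}` for the CHOSEN realising q-idele) fed to this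
seat's real-shell window (`CandInternal2RealStrata.not_mem_topLabel_of_large_l`, p451037); inputs ⊆ the frozen FACT-LIST (nothing new consumed);
standard axioms. «refuted as typed» ≠ «refuted in print»; typed ≠ proved.

RESULTS. §1 (field level, any `K/ℚ_7` of the MLF class, `‖q‖ = 7^{−k/l}`, `l = 2·l⋇ + 1`): `logRadiusB_seven_add_one_lt` (`e ≤ E`, `7E < 6·7^M` ⟹
`b_e + 1 < M`); **`not_mem_topLabel_seven`**: `4·l·M ≤ k·(l−3)(l+1)` ⟹ `q ∉ q^{l⋇²}·ℐ_K` — the integer trigger of the top-label negative. §2 AT THE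
GENUINE DATUM: **`i06star_topLabel_false_lamSeven`** — for `k ≥ 1`, `l` prime `≥ 11`, every genuine Θ-volume datum `T` at `(ratPoint λ_k, l)` and
integers `M` with `7·46080·l(l−1)²(l+1) < 6·7^M` and `4·l·M ≤ k·(l−3)(l+1)`: there is a bad place `x₀ | 7` of `T.K` with `‖t_q(x₀)‖ = 7^{−k/l}` at which
`t_q(x₀) ∉ t_q(x₀)^{l⋇²} · ℐ_{K_{x₀}}` (MODEL-FREE: only the print-side ramification bound); `…_of_ramification_le` (the same for EVERY fibre point
with a user-supplied ramification bound `e ≤ E`, e.g. R-W's local-model assumption A1 `e ∣ 30·l`); numeric rows `…_l11` (`k ≥ 6`), `…_l13` (`k ≥ 5`),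
and under A1 (`E = 30·l`, `l ≤ 68`): `…_A1` (`16·l ≤ k·(l−3)(l+1)`, i.e. `k ≥ 2` at `l ∈ {11, 13}`). READING (neutral): on the genuine family of
record the binding cell of I06⋆ is REFUTED AS TYPED by a kernel theorem at every `(k, l)` past an explicit integer threshold — the R-H twin of R-W's
HEX-SHARP; no judgement on the printed inequality or on any author's reading of (Ind3). [claim: Mochizuki2012, status: disputed] for the quoted
readings; [cite: MochizukiAbsTopIII2015, Def 5.4 (iii) p. 126]; [cite: Mochizuki2012, IUTchIV Prop. 1.2 p. 10, Cor. 2.2 (ii) proof (P5) p. 46].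
-/

noncomputable section

open NumberField IsDedekindDomain

namespace Summit.ABC.IUTFork.Repair.CandInternal2RealHex

open Set Metric
open scoped Pointwise
open Thm311 Thm311.Real Cor312 Cor312Prov Literature.IUT.LogVolume Literature.IUT.HodgeTheaters Literature.IUT.LogThetaLattice
  Literature.NumberTheory.NumberFields Literature.NumberTheory.DiophantineGeometry.GenEll Literature.NumberTheory.DiophantineGeometry
  Literature.AnabelianGeometry.AbsoluteAnabelian Summit.ABC.IUTFork.Conditional
  Summit.ABC.IUTFork.Repair.CandInternal2RealLabels Summit.ABC.IUTFork.Repair.CandInternal2RealStrata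

/-! ## 1. Field level over `ℚ_7`: the integer trigger of the top-label negative -/

/-- **`b_e + 1 < M`** from `1 ≤ e ≤ E` and `7·E < 6·7^M` (`b_e = ⌊log_7(7e/6)⌋ − 1/e`). [claim: Mochizuki2012, status: disputed] -/
theorem logRadiusB_seven_add_one_lt {e E M : ℕ} (he1 : 1 ≤ e) (heE : e ≤ E) (hM : 7 * E < 6 * 7 ^ M) :
    logRadiusB 7 e + 1 < M := by
  have hlog7 : 0 < Real.log 7 := Real.log_pos (by norm_num)
  have he0 : (0 : ℝ) < e := by exact_mod_cast he1
  have hx0 : 0 < (7 : ℝ) * e / ((7 : ℝ) - 1) := by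
    apply div_pos <;> nlinarith
  have hxM : (7 : ℝ) * e / ((7 : ℝ) - 1) < (7 : ℝ) ^ M := by
    have h1 : (7 : ℝ) * e ≤ 7 * E := by exact_mod_cast Nat.mul_le_mul_left 7 heE
    have h2 : (7 : ℝ) * E < 6 * 7 ^ M := by exact_mod_cast hM
    rw [div_lt_iff₀ (by norm_num : (0 : ℝ) < 7 - 1)]
    linarith
  have hlt : Real.log ((7 : ℝ) * e / ((7 : ℝ) - 1)) / Real.log 7 < M := by
    rw [div_lt_iff₀ hlog7, ← Real.log_pow]
    exact Real.log_lt_log hx0 hxM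
  have hfloor : (⌊Real.log ((7 : ℝ) * e / ((7 : ℝ) - 1)) / Real.log 7⌋ : ℝ) ≤ (M : ℝ) - 1 := by
    have h1 : ⌊Real.log ((7 : ℝ) * e / ((7 : ℝ) - 1)) / Real.log 7⌋ < (M : ℤ) := Int.floor_lt.2 (by exact_mod_cast hlt)
    have h2 : ⌊Real.log ((7 : ℝ) * e / ((7 : ℝ) - 1)) / Real.log 7⌋ ≤ (M : ℤ) - 1 := by omega
    exact_mod_cast h2
  have hinv : 0 < 1 / (e : ℝ) := by positivity
  rw [logRadiusB]
  push_cast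
  linarith

section Field

variable (K : Type*) [NontriviallyNormedField K] [NormedAlgebra ℚ_[7] K] [IsUltrametricDist K] [ProperSpace K]

/-- **TOP-LABEL NEGATIVE over `ℚ_7`, integer trigger.** For `q ∈ K` with `‖q‖ = 7^{−k/l}` (`l` odd, `l ≥ 3`), ramification `e ≤ E`, `7·E < 6·7^M` and
`4·l·M ≤ k·(l−3)(l+1)`: `q ∉ q^{l⋇²} · ℐ_K`, `l⋇ = (l−1)/2`. [cite: MochizukiAbsTopIII2015, Def 5.4 (iii) p. 126] [claim: Mochizuki2012, status: disputed] -/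
theorem not_mem_topLabel_seven {q : K} {k l M E : ℕ} (hl3 : 3 ≤ l) (hodd : Odd l)
    (hq : ‖q‖ = (7 : ℝ) ^ (-((k : ℝ) / l))) (heE : absRamificationIdx 7 K ≤ E) (hM : 7 * E < 6 * 7 ^ M)
    (hkM : 4 * l * M ≤ k * ((l - 3) * (l + 1))) :
    q ∉ q ^ (((l - 1) / 2) ^ 2) • logShell (PadicLogOnUnits.ofUnitLog 7 K) := by
  obtain ⟨k', rfl⟩ := hodd
  have hk' : (2 * k' + 1 - 1) / 2 = k' := by omega
  rw [hk']
  have he1 := absRamificationIdx_pos 7 K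
  have hbM : logRadiusB 7 (absRamificationIdx 7 K) + 1 < M := logRadiusB_seven_add_one_lt he1 heE hM
  have hL0 : (0 : ℝ) < 2 * (k' : ℝ) + 1 := by positivity
  have hqN : ‖q‖ ^ (2 * (2 * k' + 1)) = ((7 : ℕ) : ℝ) ^ (-(2 * (k : ℝ))) := by
    rw [hq, ← Real.rpow_natCast, ← Real.rpow_mul (by norm_num : (0 : ℝ) ≤ 7)]
    push_cast
    congr 1
    field_simp
  refine not_mem_topLabel_of_large_l 7 K k' hqN ?_
  have hc : ((if (7 : ℕ) = 2 then 2 else 1 : ℕ) : ℝ) = 1 := by norm_num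
  rw [hc]
  have hkM' : (4 : ℝ) * (2 * k' + 1) * M ≤ k * ((2 * (k' : ℝ) + 1 - 3) * (2 * k' + 1 + 1)) := by
    have h := (Nat.cast_le (α := ℝ)).2 hkM
    rw [Nat.cast_mul, Nat.cast_mul, Nat.cast_mul, Nat.cast_mul, Nat.cast_sub hl3] at h
    push_cast at h
    linarith
  have h8 : (8 : ℝ) * (2 * k' + 1) * (logRadiusB 7 (absRamificationIdx 7 K) + 1) < 8 * (2 * k' + 1) * M :=
    mul_lt_mul_of_pos_left hbM (by positivity)
  push_cast
  nlinarith

end Field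

/-! ## 2. At the genuine `λ_k` datum of record -/

/-- **HEX-I06STAR-NEG (MODEL-FREE).** `k ≥ 1`, `l` prime `≥ 11`, `T` a genuine Θ-volume datum at `(ratPoint λ_k, l)`; integers `M` with
`7·46080·l(l−1)²(l+1) < 6·7^M` and `4·l·M ≤ k·(l−3)(l+1)`. Then at some bad place `x₀ | 7` of `T.K` the CHOSEN realising q-idele has
`‖t_q(x₀)‖ = 7^{−k/l}` and `t_q(x₀) ∉ t_q(x₀)^{l⋇²} · ℐ_{K_{x₀}}`: the top-label cell of RP-I06⋆ at that genuine place is REFUTED AS TYPED.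
[cite: Mochizuki2012, IUTchIV Cor. 2.2 (ii) proof (P5) p. 46] [cite: MochizukiAbsTopIII2015, Def 5.4 (iii) p. 126] [claim: Mochizuki2012, status: disputed] -/
theorem i06star_topLabel_false_lamSeven {k l M : ℕ} (hk : 1 ≤ k) (hl : l.Prime) (h11 : 11 ≤ l)
    (hM : 7 * (46080 * (l * (l - 1) ^ 2 * (l + 1))) < 6 * 7 ^ M) (hkM : 4 * l * M ≤ k * ((l - 3) * (l + 1)))
    (T : Cor22.ThetaVolumeDatumAt (ratPoint ((2 : ℚ)⁻¹ + 2 / 7 ^ k)) l) :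
    letI := T.instFieldF; letI := T.instNumberFieldF; letI := T.instAlgebraF; letI := T.instFieldK
    letI := T.instNumberFieldK; letI := T.instAlgebraK; letI := T.instFieldFbar; letI := T.instAlgebraFbar
    letI := T.instAlgebraKFbar; letI := T.instIsElliptic
    haveI : Fact (Nat.Prime 7) := ⟨by norm_num⟩
    ∃ x₀ : (thetaIndex (pilotDataOfK T.D T.K)).Fibre (.inr ⟨7, by norm_num⟩),
      placeOf (pilotDataOfK T.D T.K) 7 x₀ ∈ (pilotDataOfK T.D T.K).S ∧
      ‖(exists_realising_qIdeles_pilotDataOfK T.D).choose ⟨7, by norm_num⟩ x₀‖ = (7 : ℝ) ^ (-((k : ℝ) / l)) ∧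
      (exists_realising_qIdeles_pilotDataOfK T.D).choose ⟨7, by norm_num⟩ x₀ ∉
        (exists_realising_qIdeles_pilotDataOfK T.D).choose ⟨7, by norm_num⟩ x₀ ^ (((l - 1) / 2) ^ 2) •
          logShell (PadicLogOnUnits.ofUnitLog 7 (kOf (pilotDataOfK T.D T.K) 7 x₀)) := by
  letI := T.instFieldF; letI := T.instNumberFieldF; letI := T.instAlgebraF; letI := T.instFieldK
  letI := T.instNumberFieldK; letI := T.instAlgebraK; letI := T.instFieldFbar; letI := T.instAlgebraFbar
  letI := T.instAlgebraKFbar; letI := T.instIsElliptic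
  haveI : Fact (Nat.Prime 7) := ⟨by norm_num⟩
  obtain ⟨x₀, hS, -, hbound, -, hnorm⟩ := GenuineK.exists_place_lamSeven hk hl h11 T
  exact ⟨x₀, hS, hnorm, not_mem_topLabel_seven (kOf (pilotDataOfK T.D T.K) 7 x₀) (by omega) (hl.odd_of_ne_two (by omega))
    hnorm hbound hM hkM⟩

/-- **HEX-I06STAR-NEG at EVERY fibre point with a supplied ramification bound** (e.g. R-W's local-model assumption A1 `e(x₀) ∣ 30·l`, so `E = 30·l`):
for any `x₀ | 7` at which the chosen q-idele has `‖t_q(x₀)‖ = 7^{−k/l}`, `e(K_{x₀}) ≤ E`, `7·E < 6·7^M`, `4·l·M ≤ k·(l−3)(l+1)` ⟹ the top-label cell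
FAILS there. [claim: Mochizuki2012, status: disputed] -/
theorem i06star_topLabel_false_of_ramification_le {k l M E : ℕ} (hl : l.Prime) (h5 : 5 ≤ l)
    (hM : 7 * E < 6 * 7 ^ M) (hkM : 4 * l * M ≤ k * ((l - 3) * (l + 1)))
    (T : Cor22.ThetaVolumeDatumAt (ratPoint ((2 : ℚ)⁻¹ + 2 / 7 ^ k)) l) :
    letI := T.instFieldF; letI := T.instNumberFieldF; letI := T.instAlgebraF; letI := T.instFieldK
    letI := T.instNumberFieldK; letI := T.instAlgebraK; letI := T.instFieldFbar; letI := T.instAlgebraFbar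
    letI := T.instAlgebraKFbar; letI := T.instIsElliptic
    haveI : Fact (Nat.Prime 7) := ⟨by norm_num⟩
    ∀ x₀ : (thetaIndex (pilotDataOfK T.D T.K)).Fibre (.inr ⟨7, by norm_num⟩),
      ‖(exists_realising_qIdeles_pilotDataOfK T.D).choose ⟨7, by norm_num⟩ x₀‖ = (7 : ℝ) ^ (-((k : ℝ) / l)) →
      absRamificationIdx 7 (kOf (pilotDataOfK T.D T.K) 7 x₀) ≤ E →
      (exists_realising_qIdeles_pilotDataOfK T.D).choose ⟨7, by norm_num⟩ x₀ ∉
        (exists_realising_qIdeles_pilotDataOfK T.D).choose ⟨7, by norm_num⟩ x₀ ^ (((l - 1) / 2) ^ 2) •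
          logShell (PadicLogOnUnits.ofUnitLog 7 (kOf (pilotDataOfK T.D T.K) 7 x₀)) := by
  letI := T.instFieldF; letI := T.instNumberFieldF; letI := T.instAlgebraF; letI := T.instFieldK
  letI := T.instNumberFieldK; letI := T.instAlgebraK; letI := T.instFieldFbar; letI := T.instAlgebraFbar
  letI := T.instAlgebraKFbar; letI := T.instIsElliptic
  haveI : Fact (Nat.Prime 7) := ⟨by norm_num⟩
  intro x₀ hnorm he
  exact not_mem_topLabel_seven (kOf (pilotDataOfK T.D T.K) 7 x₀) (by omega) (hl.odd_of_ne_two (by omega)) hnorm he hM hkM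

/-! ## 3. Numeric rows for the table (thresholds in `k`) -/

/-- **`l = 11`, model-free: every `k ≥ 6`** (`M = 11`: `7·46080·11·100·12 = 4257792000 < 6·7^11`; `4·11·11 = 484 ≤ 96·k`).
[claim: Mochizuki2012, status: disputed] -/
theorem i06star_topLabel_false_lamSeven_l11 {k : ℕ} (hk : 6 ≤ k) (T : Cor22.ThetaVolumeDatumAt (ratPoint ((2 : ℚ)⁻¹ + 2 / 7 ^ k)) 11) :
    letI := T.instFieldF; letI := T.instNumberFieldF; letI := T.instAlgebraF; letI := T.instFieldK
    letI := T.instNumberFieldK; letI := T.instAlgebraK; letI := T.instFieldFbar; letI := T.instAlgebraFbar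
    letI := T.instAlgebraKFbar; letI := T.instIsElliptic
    haveI : Fact (Nat.Prime 7) := ⟨by norm_num⟩
    ∃ x₀ : (thetaIndex (pilotDataOfK T.D T.K)).Fibre (.inr ⟨7, by norm_num⟩),
      placeOf (pilotDataOfK T.D T.K) 7 x₀ ∈ (pilotDataOfK T.D T.K).S ∧
      ‖(exists_realising_qIdeles_pilotDataOfK T.D).choose ⟨7, by norm_num⟩ x₀‖ = (7 : ℝ) ^ (-((k : ℝ) / (11 : ℕ))) ∧
      (exists_realising_qIdeles_pilotDataOfK T.D).choose ⟨7, by norm_num⟩ x₀ ∉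
        (exists_realising_qIdeles_pilotDataOfK T.D).choose ⟨7, by norm_num⟩ x₀ ^ (((11 - 1) / 2) ^ 2) •
          logShell (PadicLogOnUnits.ofUnitLog 7 (kOf (pilotDataOfK T.D T.K) 7 x₀)) :=
  i06star_topLabel_false_lamSeven (M := 11) (by omega) (by norm_num) le_rfl (by norm_num) (by omega) T

/-- **`l = 13`, model-free: every `k ≥ 5`** (`M = 11`: `7·46080·13·144·14 < 6·7^11`; `4·13·11 = 572 ≤ 140·k`). [claim: Mochizuki2012, status: disputed] -/
theorem i06star_topLabel_false_lamSeven_l13 {k : ℕ} (hk : 5 ≤ k) (T : Cor22.ThetaVolumeDatumAt (ratPoint ((2 : ℚ)⁻¹ + 2 / 7 ^ k)) 13) :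
    letI := T.instFieldF; letI := T.instNumberFieldF; letI := T.instAlgebraF; letI := T.instFieldK
    letI := T.instNumberFieldK; letI := T.instAlgebraK; letI := T.instFieldFbar; letI := T.instAlgebraFbar
    letI := T.instAlgebraKFbar; letI := T.instIsElliptic
    haveI : Fact (Nat.Prime 7) := ⟨by norm_num⟩
    ∃ x₀ : (thetaIndex (pilotDataOfK T.D T.K)).Fibre (.inr ⟨7, by norm_num⟩),
      placeOf (pilotDataOfK T.D T.K) 7 x₀ ∈ (pilotDataOfK T.D T.K).S ∧
      ‖(exists_realising_qIdeles_pilotDataOfK T.D).choose ⟨7, by norm_num⟩ x₀‖ = (7 : ℝ) ^ (-((k : ℝ) / (13 : ℕ))) ∧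
      (exists_realising_qIdeles_pilotDataOfK T.D).choose ⟨7, by norm_num⟩ x₀ ∉
        (exists_realising_qIdeles_pilotDataOfK T.D).choose ⟨7, by norm_num⟩ x₀ ^ (((13 - 1) / 2) ^ 2) •
          logShell (PadicLogOnUnits.ofUnitLog 7 (kOf (pilotDataOfK T.D T.K) 7 x₀)) :=
  i06star_topLabel_false_lamSeven (M := 11) (by omega) (by norm_num) (by norm_num) (by norm_num) (by omega) T

/-- **Under R-W's local-model assumption A1 (`e(x₀) ≤ 30·l`) and `l ≤ 68`** (`7·30·l < 6·7^4`, `M = 4`): the top-label cell FAILS at every such fibre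
point as soon as `16·l ≤ k·(l−3)(l+1)` — i.e. `k ≥ 2` at `l ∈ {11, 13}`. A1 is R-W's flagged model input (kit job N1), taken here as a HYPOTHESIS on
the place, never asserted. [claim: Mochizuki2012, status: disputed] -/
theorem i06star_topLabel_false_A1 {k l : ℕ} (hl : l.Prime) (h5 : 5 ≤ l) (hl68 : l ≤ 68) (hk : 16 * l ≤ k * ((l - 3) * (l + 1)))
    (T : Cor22.ThetaVolumeDatumAt (ratPoint ((2 : ℚ)⁻¹ + 2 / 7 ^ k)) l) :
    letI := T.instFieldF; letI := T.instNumberFieldF; letI := T.instAlgebraF; letI := T.instFieldK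
    letI := T.instNumberFieldK; letI := T.instAlgebraK; letI := T.instFieldFbar; letI := T.instAlgebraFbar
    letI := T.instAlgebraKFbar; letI := T.instIsElliptic
    haveI : Fact (Nat.Prime 7) := ⟨by norm_num⟩
    ∀ x₀ : (thetaIndex (pilotDataOfK T.D T.K)).Fibre (.inr ⟨7, by norm_num⟩),
      ‖(exists_realising_qIdeles_pilotDataOfK T.D).choose ⟨7, by norm_num⟩ x₀‖ = (7 : ℝ) ^ (-((k : ℝ) / l)) →
      absRamificationIdx 7 (kOf (pilotDataOfK T.D T.K) 7 x₀) ≤ 30 * l →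
      (exists_realising_qIdeles_pilotDataOfK T.D).choose ⟨7, by norm_num⟩ x₀ ∉
        (exists_realising_qIdeles_pilotDataOfK T.D).choose ⟨7, by norm_num⟩ x₀ ^ (((l - 1) / 2) ^ 2) •
          logShell (PadicLogOnUnits.ofUnitLog 7 (kOf (pilotDataOfK T.D T.K) 7 x₀)) :=
  i06star_topLabel_false_of_ramification_le (M := 4) (E := 30 * l) hl h5 (by omega) (by omega) T

end Summit.ABC.IUTFork.Repair.CandInternal2RealHex

end
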